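import Mathlib

/-!
# Degeneration of a subspace to its initial subspace for a coordinate weight (torus limits)

Topic `Literature/Computability/AlgebraicComplexity`. Elementary linear algebra behind the
one-parameter-torus limits used in border apolarity (Conner–Harper–Landsberg 2023, §2.4: "it is
sufficient to disprove the existence of a border rank decomposition where `E₀` is a `𝔹_T`-fixed
point", here only for the maximal TORUS): for a weight `e : σ → ℕ` on the coordinates of `K^σ`
(the exponents of a one-parameter subgroup acting diagonally), every subspace `W ⊆ K^σ` degenerates,
under `t ↦ diag(t^{-e})` as `t → 0`, to its **initial subspace** `gr_e W` spanned by the top-weight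
components of its elements. Everything here is PROVED:

* `GradedLimit.wtPart e n` (the weight-`n` component), `GradedLimit.topWt`, `GradedLimit.topPart`,
  `GradedLimit.grSub e W = span {topPart v : v ∈ W}`, `GradedLimit.IsGraded`.
* `GradedLimit.isGraded_grSub` — the limit is spanned by weight vectors (torus fixed);
  `GradedLimit.grSub_le` — it stays inside any graded subspace containing `W`;
  `GradedLimit.le_grSub_of_isGraded` — it contains every graded subspace of `W`;
* `GradedLimit.finrank_grSub` — **`dim gr_e W = dim W`** (induction on `dim W`, splitting off the
  top weight: `gr W = gr (W ∩ ker π_n) ⊕ π_n(W)`).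

The formulation (coordinates, `ℕ`-weights) is ours; the statement is the standard flatness of
torus degenerations in a Grassmannian.

## References

* A. Conner, A. Harper, J. M. Landsberg, *New lower bounds for matrix multiplication and `det₃`*,
  Forum Math. Pi 11 (2023) e17, arXiv:1911.07981, §2.4–§2.5 (Borel/torus fixed subspaces are spanned
  by weight vectors).
-/

noncomputable section

open Module

namespace Literature.Computability.AlgebraicComplexity

namespace GradedLimit

variable {K : Type*} [Field K] {σ : Type*} (e : σ → ℕ)

/-- The weight-`n` component of a coordinate vector for the weight `e`. [folklore] -/
def wtPart (n : ℕ) : (σ → K) →ₗ[K] (σ → K) where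
  toFun v s := if e s = n then v s else 0
  map_add' v w := by
    ext s
    simp only [Pi.add_apply]
    split_ifs <;> simp
  map_smul' c v := by
    ext s
    simp only [Pi.smul_apply, smul_eq_mul, RingHom.id_apply]
    split_ifs <;> simp

/-- Entries of a weight component. [folklore] -/
@[simp] theorem wtPart_apply (n : ℕ) (v : σ → K) (s : σ) :
    wtPart e n v s = if e s = n then v s else 0 := rfl

/-- Components of different weights: `π_n ∘ π_m = δ_{nm} π_n`. [folklore] -/
theorem wtPart_wtPart (n m : ℕ) (v : σ → K) :
    wtPart e n (wtPart e m v) = if n = m then wtPart e n v else 0 := by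
  ext s
  by_cases hnm : n = m
  · subst hnm
    simp only [wtPart_apply, if_true]
    split_ifs <;> rfl
  · simp only [wtPart_apply, if_neg hnm, Pi.zero_apply]
    split_ifs with h1 h2
    · exact absurd (h1.symm.trans h2) hnm
    · rfl
    · rfl

/-- Vectors with no component of weight `> n`. [folklore] -/
def Vle (n : ℕ) : Submodule K (σ → K) where
  carrier := {v | ∀ s, n < e s → v s = 0}
  add_mem' hv hw s hs := by simp [hv s hs, hw s hs]
  zero_mem' _ _ := rfl
  smul_mem' c v hv s hs := by simp [hv s hs]

/-- Membership in `Vle`. [folklore] -/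
theorem mem_Vle {n : ℕ} {v : σ → K} : v ∈ Vle e n ↔ ∀ s, n < e s → v s = 0 := Iff.rfl

/-- A weight-`n` component has no component above `n`. [folklore] -/
theorem wtPart_mem_Vle (n : ℕ) (v : σ → K) : wtPart e n v ∈ Vle e n := by
  intro s hs
  simp [Nat.ne_of_gt hs]

variable [Fintype σ]

/-- The top weight occurring in `v` (`0` for `v = 0`). [folklore] -/
def topWt [DecidableEq K] (v : σ → K) : ℕ :=
  (Finset.univ.filter fun s => v s ≠ 0).sup e

variable [DecidableEq K]

/-- Weights in the support are at most the top weight. [folklore] -/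
theorem le_topWt {v : σ → K} {s : σ} (hs : v s ≠ 0) : e s ≤ topWt e v :=
  Finset.le_sup (f := e) (Finset.mem_filter.2 ⟨Finset.mem_univ _, hs⟩)

/-- A vector has no component above its top weight. [folklore] -/
theorem mem_Vle_topWt (v : σ → K) : v ∈ Vle e (topWt e v) := by
  intro s hs
  by_contra h
  exact absurd (le_topWt e h) (not_le.2 hs)

/-- The top weight of a vector with no component above `n` is `≤ n`. [folklore] -/
theorem topWt_le_of_mem_Vle {n : ℕ} {v : σ → K} (hv : v ∈ Vle e n) : topWt e v ≤ n := by
  refine Finset.sup_le fun s hs => ?_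
  rw [Finset.mem_filter] at hs
  by_contra h
  exact hs.2 (hv s (not_le.1 h))

/-- A non-zero vector has a non-zero top-weight component. [folklore] -/
theorem wtPart_topWt_ne_zero {v : σ → K} (hv : v ≠ 0) : wtPart e (topWt e v) v ≠ 0 := by
  have hne : (Finset.univ.filter fun s => v s ≠ 0).Nonempty := by
    obtain ⟨s, hs⟩ := Function.ne_iff.1 hv
    exact ⟨s, Finset.mem_filter.2 ⟨Finset.mem_univ _, hs⟩⟩
  obtain ⟨s₀, hs₀, hmax⟩ := Finset.exists_mem_eq_sup _ hne e
  rw [Finset.mem_filter] at hs₀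
  intro h0
  have := congrFun h0 s₀
  simp only [wtPart_apply, Pi.zero_apply, topWt, hmax, if_true] at this
  exact hs₀.2 this

/-- If `v` has no component above `n` and a non-zero component of weight `n`, its top weight is `n`.
[folklore] -/
theorem topWt_eq_of_mem_Vle {n : ℕ} {v : σ → K} (hv : v ∈ Vle e n) (hn : wtPart e n v ≠ 0) :
    topWt e v = n := by
  refine le_antisymm (topWt_le_of_mem_Vle e hv) ?_
  obtain ⟨s, hs⟩ : ∃ s, wtPart e n v s ≠ 0 := Function.ne_iff.1 hn
  simp only [wtPart_apply, ne_eq, ite_eq_right_iff, Classical.not_imp] at hs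
  exact hs.1 ▸ le_topWt e hs.2

/-- The top-weight component ("initial form") of `v`. [folklore] -/
def topPart (v : σ → K) : σ → K :=
  wtPart e (topWt e v) v

/-- The initial form of `0`. [folklore] -/
theorem topPart_zero : topPart e (0 : σ → K) = 0 := by
  simp [topPart]

/-- **The initial subspace** `gr_e W = span {topPart v : v ∈ W}` — the limit of `W` under the torus
`diag(t^{-e})`, `t → 0`. [cite: ConnerHarperLandsberg2023, §2.4] -/
def grSub (W : Submodule K (σ → K)) : Submodule K (σ → K) :=
  Submodule.span K (topPart e '' (W : Set (σ → K)))

/-- Initial forms of elements of `W` lie in `gr W`. [folklore] -/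
theorem topPart_mem_grSub {W : Submodule K (σ → K)} {v : σ → K} (hv : v ∈ W) :
    topPart e v ∈ grSub e W :=
  Submodule.subset_span ⟨v, hv, rfl⟩

/-- `gr` is monotone. [folklore] -/
theorem grSub_mono {W W' : Submodule K (σ → K)} (h : W ≤ W') : grSub e W ≤ grSub e W' :=
  Submodule.span_mono (Set.image_mono h)

/-- A component of `v ∈ W` at a weight bounding `v` from above is an initial form (or zero).
[folklore] -/
theorem wtPart_mem_grSub {W : Submodule K (σ → K)} {v : σ → K} {n : ℕ} (hv : v ∈ W)
    (hn : v ∈ Vle e n) : wtPart e n v ∈ grSub e W := by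
  by_cases h0 : wtPart e n v = 0
  · rw [h0]
    exact Submodule.zero_mem _
  · have := topWt_eq_of_mem_Vle e hn h0
    have ht : topPart e v = wtPart e n v := by rw [topPart, this]
    rw [← ht]
    exact topPart_mem_grSub e hv

/-- A subspace is *graded* (torus stable) if it contains the weight components of its elements.
[cite: ConnerHarperLandsberg2023, §2.5] -/
def IsGraded (W : Submodule K (σ → K)) : Prop :=
  ∀ n : ℕ, ∀ v ∈ W, wtPart e n v ∈ W

omit [Fintype σ] [DecidableEq K] in
/-- Intersections of graded subspaces are graded. [folklore] -/
theorem IsGraded.inf {W W' : Submodule K (σ → K)} (hW : IsGraded e W) (hW' : IsGraded e W') :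
    IsGraded e (W ⊓ W') :=
  fun n _ hv => ⟨hW n _ hv.1, hW' n _ hv.2⟩

/-- The initial subspace is graded (spanned by weight vectors). [cite: ConnerHarperLandsberg2023, §2.5] -/
theorem isGraded_grSub (W : Submodule K (σ → K)) : IsGraded e (grSub e W) := by
  intro n x hx
  induction hx using Submodule.span_induction with
  | mem x hx =>
    obtain ⟨v, hv, rfl⟩ := hx
    rw [topPart, wtPart_wtPart]
    split_ifs with h
    · subst h
      exact topPart_mem_grSub e hv
    · exact Submodule.zero_mem _
  | zero => simp
  | add x y _ _ hx hy =>
    rw [map_add]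
    exact Submodule.add_mem _ hx hy
  | smul c x _ hx =>
    rw [map_smul]
    exact Submodule.smul_mem _ c hx

/-- The initial subspace stays inside every graded subspace containing `W`.
[cite: ConnerHarperLandsberg2023, §2.4] -/
theorem grSub_le {W Y : Submodule K (σ → K)} (hWY : W ≤ Y) (hY : IsGraded e Y) :
    grSub e W ≤ Y := by
  refine Submodule.span_le.2 ?_
  rintro _ ⟨v, hv, rfl⟩
  exact hY _ _ (hWY hv)

omit [DecidableEq K] in
/-- A vector is the sum of its weight components. [folklore] -/
theorem sum_wtPart [DecidableEq σ] (v : σ → K) : ∑ n ∈ Finset.univ.image e, wtPart e n v = v := by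
  ext s
  rw [Finset.sum_apply, Finset.sum_eq_single (e s)]
  · simp
  · intro n _ hn
    simp [Ne.symm hn]
  · intro h
    exact absurd (Finset.mem_image_of_mem e (Finset.mem_univ s)) h

/-- A graded subspace of `W` lies in the initial subspace of `W`. [folklore] -/
theorem le_grSub_of_isGraded [DecidableEq σ] {W' W : Submodule K (σ → K)} (hW' : IsGraded e W')
    (h : W' ≤ W) : W' ≤ grSub e W := by
  intro v hv
  rw [← sum_wtPart e v]
  refine Submodule.sum_mem _ fun n _ => ?_
  have hmem : wtPart e n v ∈ W := h (hW' n v hv)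
  have := wtPart_mem_grSub e hmem (wtPart_mem_Vle e n v)
  rwa [wtPart_wtPart, if_pos rfl] at this

/-- The initial subspace of the zero subspace. [folklore] -/
theorem grSub_bot : grSub e (⊥ : Submodule K (σ → K)) = ⊥ := by
  rw [grSub, Submodule.span_eq_bot]
  rintro _ ⟨v, hv, rfl⟩
  rw [show v = 0 from hv, topPart_zero]

/-- **`dim gr_e W = dim W`**: a torus degeneration preserves the dimension.
[cite: ConnerHarperLandsberg2023, §2.2 (limits taken in the Grassmannian)] -/
theorem finrank_grSub (W : Submodule K (σ → K)) : finrank K (grSub e W) = finrank K W := by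
  classical
  -- strong induction on the dimension
  suffices H : ∀ d : ℕ, ∀ W : Submodule K (σ → K), finrank K W = d →
      finrank K (grSub e W) = d from H _ W rfl
  intro d
  induction d using Nat.strong_induction_on with
  | _ d ih =>
  intro W hW
  by_cases hbot : W = ⊥
  · subst hbot
    rw [grSub_bot]
    simpa using hW
  -- a coordinate of maximal weight in the support of `W`
  have hT : (Finset.univ.filter fun s : σ => ∃ v ∈ W, v s ≠ 0).Nonempty := by
    obtain ⟨v, hvW, hv0⟩ := (Submodule.ne_bot_iff W).1 hbot
    obtain ⟨s, hs⟩ : ∃ s, v s ≠ 0 := Function.ne_iff.1 hv0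
    exact ⟨s, Finset.mem_filter.2 ⟨Finset.mem_univ _, v, hvW, hs⟩⟩
  obtain ⟨s₀, hs₀, hmax⟩ := Finset.exists_max_image _ e hT
  obtain ⟨-, v₀, hv₀W, hv₀s⟩ := Finset.mem_filter.1 hs₀
  set n := e s₀ with hn
  have hWle : W ≤ Vle e n := by
    intro v hv s hs
    by_contra h
    have := hmax s (Finset.mem_filter.2 ⟨Finset.mem_univ _, v, hv, h⟩)
    exact absurd this (not_le.2 hs)
  -- split off the weight-`n` part: `G = W ∩ ker π_n`, `Wn = π_n(W)`
  set φ : W →ₗ[K] (σ → K) := (wtPart e n).domRestrict W with hφ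
  set Wn : Submodule K (σ → K) := LinearMap.range φ with hWn
  set G : Submodule K (σ → K) := (LinearMap.ker φ).map W.subtype with hG
  have hGW : G ≤ W := by
    rintro _ ⟨x, -, rfl⟩
    exact x.2
  have hGker : ∀ v ∈ G, wtPart e n v = 0 := by
    rintro _ ⟨x, hx, rfl⟩
    simpa [hφ] using hx
  have hdim : finrank K G + finrank K Wn = d := by
    have h1 := LinearMap.finrank_range_add_finrank_ker φ
    rw [← hWn, hW] at h1
    have h2 : finrank K G = finrank K (LinearMap.ker φ) :=
      Submodule.finrank_map_subtype_eq W (LinearMap.ker φ)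
    omega
  have hWn_pos : 0 < finrank K Wn := by
    rw [Module.finrank_pos_iff_exists_ne_zero]
    refine ⟨⟨wtPart e n v₀, ⟨⟨v₀, hv₀W⟩, rfl⟩⟩, fun h => ?_⟩
    have h' : wtPart e n v₀ = 0 := congrArg Subtype.val h
    have := congrFun h' s₀
    simp only [wtPart_apply, ← hn, if_true, Pi.zero_apply] at this
    exact hv₀s this
  have hGlt : finrank K G < d := by omega
  have ihG := ih _ hGlt G rfl
  -- `gr W = gr G ⊔ Wn` and `gr G ⊓ Wn = ⊥`
  have hWn_le : Wn ≤ grSub e W := by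
    rintro _ ⟨⟨v, hv⟩, rfl⟩
    exact wtPart_mem_grSub e hv (hWle hv)
  have key1 : grSub e W = grSub e G ⊔ Wn := by
    apply le_antisymm
    · refine Submodule.span_le.2 ?_
      rintro _ ⟨v, hv, rfl⟩
      by_cases h0 : wtPart e n v = 0
      · have hvG : v ∈ G := ⟨⟨v, hv⟩, by simpa [hφ] using h0, rfl⟩
        exact Submodule.mem_sup_left (topPart_mem_grSub e hvG)
      · have ht : topWt e v = n := topWt_eq_of_mem_Vle e (hWle hv) h0
        refine Submodule.mem_sup_right ⟨⟨v, hv⟩, ?_⟩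
        simp [hφ, topPart, ht]
    · exact sup_le (grSub_mono e hGW) hWn_le
  have key2 : grSub e G ⊓ Wn = ⊥ := by
    rw [eq_bot_iff]
    rintro x ⟨hxG, hxW⟩
    -- elements of `gr G` have no weight-`n` component, elements of `Wn` are of weight `n`
    have hx1 : wtPart e n x = 0 := by
      have hle : grSub e G ≤ LinearMap.ker (wtPart e n) := by
        refine Submodule.span_le.2 ?_
        rintro _ ⟨v, hv, rfl⟩
        rw [SetLike.mem_coe, LinearMap.mem_ker, topPart, wtPart_wtPart]
        split_ifs with hnv
        · by_cases hv0 : v = 0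
          · simp [hv0]
          · exact absurd (hnv ▸ hGker v hv) (wtPart_topWt_ne_zero e hv0)
        · rfl
      exact hle hxG
    have hx2 : wtPart e n x = x := by
      obtain ⟨⟨v, hv⟩, rfl⟩ := hxW
      simp [hφ, wtPart_wtPart]
    rw [Submodule.mem_bot, ← hx2, hx1]
  have := Submodule.finrank_sup_add_finrank_inf_eq (grSub e G) Wn
  rw [key2, finrank_bot, add_zero, ← key1, ihG] at this
  omega

end GradedLimit

end Literature.Computability.AlgebraicComplexity

end
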